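import Literature.RingTheory.MvPowerSeries.OfAnalytic
import Mathlib.Analysis.Analytic.ChangeOrigin
import Mathlib.Analysis.Analytic.Constructions
import HarnessLib

/-!
# Sums of convergent power series are analytic on the open polydisc of convergence

Topic `Literature/RingTheory/MvPowerSeries`.  The converse direction of `OfAnalytic.lean`: if a
power series `P ∈ 𝕜⟦Xᵢ : i ∈ ι⟧` (`ι` finite, `𝕜` a complete nontrivially normed field) has
`‖P‖_r < ∞` at the constant polyradius `r` (`wnorm`, `ConvergentPowerSeries.lean`), then its sum
`eval P : (ι → 𝕜) → 𝕜` has a power series expansion at `0`, in Mathlib's sense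
(`HasFPowerSeriesOnBall`, formal MULTILINEAR series on the sup-normed space `ι → 𝕜`), on every
ball of radius `r' < r` (`exists_hasFPowerSeriesOnBall_eval`), and consequently
**`eval P` is analytic at every point `y` with `‖yᵢ‖ < r` for all `i`** (`analyticAt_eval`;
H. Grauert, R. Remmert, *Analytische Stellenalgebren* (1971), Kap. I §§1–3; J. M. Ruiz, *The
basic theory of power series* (1993), Prop. 2.6: "a convergent power series defines an analytic
function on its polycylinder of convergence").  The re-expansion at the points `y ≠ 0` is
Mathlib's `HasFPowerSeriesOnBall.analyticAt_of_mem` (change of origin).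

## The proof

For a word `τ : Fin k → ι` let `m_τ` be the continuous `k`-linear form
`(y¹, …, yᵏ) ↦ ∏ₗ yˡ_{τ l}` (norm `≤ 1`, diagonal `m_τ(y, …, y) = y^{cnt τ}` with
`cnt τ = ∑ₗ e_{τ l}`).  Choosing for every multi-index `α` one word `w(α)` with `cnt w(α) = α`
(`exists_word_eq`), put `q_k = ∑_{τ : Fin k → ι, (k, τ) = w(cnt τ)} c_{cnt τ} m_τ`.  Then
`‖q_k‖ r'ᵏ ≤ ∑_{|α| = k} ‖c_α‖ r'^{|α|}`, so `∑ₖ ‖q_k‖ r'ᵏ ≤ ‖P‖_{r'} < ∞` and the radius of `q` is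
at least `r'`; and for `‖y‖ < r'` the family `(k, τ) ↦ [ (k,τ) = w(cnt τ) ] c_{cnt τ} y^{cnt τ}` is a
reindexing of the absolutely summable family `α ↦ c_α y^α` (sum `eval P y`, `hasSum_eval`), whence
`∑ₖ q_k(y, …, y) = eval P y` by regrouping (`HasSum.sigma`).

Everything is proved; no definitions, no named facts.

## References

* [GrauertRemmert1971] H. Grauert, R. Remmert, *Analytische Stellenalgebren*, Springer (1971),
  Kap. I §§1–3.
* [Ruiz1993] J. M. Ruiz, *The basic theory of power series*, Vieweg (1993), §2, Prop. 2.6.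
-/

noncomputable section

open MvPowerSeries Finsupp Filter
open scoped NNReal ENNReal Topology BigOperators

namespace Literature.RingTheory.MvPowerSeries

variable {ι : Type*} [Fintype ι] [DecidableEq ι] {𝕜 : Type*} [NontriviallyNormedField 𝕜]

/-! ### Words and their multilinear monomials -/

omit [Fintype ι] [DecidableEq ι] in
/-- **Every multi-index is the count vector of a word**: for `α : ι →₀ ℕ` there is a word
`τ : Fin k → ι` with `∑ₗ e_{τ l} = α` (and then `k = |α|`, `degree_sum_single`). [folklore] -/
theorem exists_word_eq (α : ι →₀ ℕ) :
    ∃ (k : ℕ) (τ : Fin k → ι), (∑ l, Finsupp.single (τ l) (1 : ℕ)) = α := by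
  induction α using Finsupp.induction with
  | zero => exact ⟨0, Fin.elim0, by simp⟩
  | single_add i n f _ _ ih =>
    obtain ⟨k, τ, hτ⟩ := ih
    refine ⟨n + k, Fin.append (fun _ : Fin n => i) τ, ?_⟩
    rw [Fin.sum_univ_add]
    simp only [Fin.append_left, Fin.append_right, hτ, Finset.sum_const, Finset.card_univ,
      Fintype.card_fin, Finsupp.smul_single, smul_eq_mul, mul_one]

omit [Fintype ι] [DecidableEq ι] in
/-- The multilinear monomial of a word: `m_τ (y¹, …, yᵏ) = ∏ₗ yˡ_{τ l}`. [folklore] -/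
theorem wordMap_apply {k : ℕ} (τ : Fin k → ι) (v : Fin k → ι → 𝕜) :
    ((ContinuousMultilinearMap.mkPiAlgebraFin 𝕜 k 𝕜).compContinuousLinearMap
      fun l => ContinuousLinearMap.proj (R := 𝕜) (φ := fun _ : ι => 𝕜) (τ l)) v = ∏ l, v l (τ l) := by
  simp only [ContinuousMultilinearMap.compContinuousLinearMap_apply, ContinuousLinearMap.proj_apply,
    ContinuousMultilinearMap.mkPiAlgebraFin_apply, List.prod_ofFn]

omit [Fintype ι] [DecidableEq ι] in
/-- On the diagonal the multilinear monomial of a word is the monomial of its count vector: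
`m_τ (y, …, y) = y^{cnt τ}`. [folklore] -/
theorem wordMap_apply_diag {k : ℕ} (τ : Fin k → ι) (y : ι → 𝕜) :
    ((ContinuousMultilinearMap.mkPiAlgebraFin 𝕜 k 𝕜).compContinuousLinearMap
      fun l => ContinuousLinearMap.proj (R := 𝕜) (φ := fun _ : ι => 𝕜) (τ l)) (fun _ => y) =
      mono y (∑ l, Finsupp.single (τ l) (1 : ℕ)) := by
  rw [wordMap_apply, mono_sum_single]

omit [DecidableEq ι] in
/-- The multilinear monomial of a word has operator norm `≤ 1` (sup norm on `ι → 𝕜`).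
[folklore] -/
theorem norm_wordMap_le {k : ℕ} (τ : Fin k → ι) :
    ‖(ContinuousMultilinearMap.mkPiAlgebraFin 𝕜 k 𝕜).compContinuousLinearMap
      fun l => ContinuousLinearMap.proj (R := 𝕜) (φ := fun _ : ι => 𝕜) (τ l)‖ ≤ 1 := by
  refine ContinuousMultilinearMap.opNorm_le_bound zero_le_one fun v => ?_
  rw [wordMap_apply, one_mul, norm_prod]
  exact Finset.prod_le_prod (fun l _ => norm_nonneg _) fun l _ => norm_le_pi_norm (v l) (τ l)

/-! ### The power series expansion of `eval P` at the origin -/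

section Complete

variable [CompleteSpace 𝕜]

/-- **The sum of a convergent power series has a power series expansion at the origin on every
smaller polydisc**: if `‖P‖_r < ∞` and `0 < r' < r`, then `eval P` has a (multilinear) power
series expansion on the ball of radius `r'` of the sup-normed space `ι → 𝕜` (Grauert–Remmert
1971, Kap. I §§1–3; Ruiz 1993, Prop. 2.6). [cite: Ruiz1993, Prop. 2.6] -/
theorem exists_hasFPowerSeriesOnBall_eval {r r' : ℝ≥0} {P : MvPowerSeries ι 𝕜}
    (hP : wnorm (fun _ : ι => r) P < ⊤) (hr' : r' < r) (h0 : 0 < r') :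
    ∃ q : FormalMultilinearSeries 𝕜 (ι → 𝕜) 𝕜, HasFPowerSeriesOnBall (eval P) q 0 r' := by
  classical
  -- a word for every multi-index
  have hw := fun α : ι →₀ ℕ => exists_word_eq α
  choose kw τw hτw using hw
  -- count vectors of words, as a function on the type of all words
  let cnt : (Σ k : ℕ, (Fin k → ι)) → (ι →₀ ℕ) := fun w => ∑ l, Finsupp.single (w.2 l) (1 : ℕ)
  let wd : (ι →₀ ℕ) → (Σ k : ℕ, (Fin k → ι)) := fun α => ⟨kw α, τw α⟩
  have hcnt_wd : ∀ α, cnt (wd α) = α := fun α => hτw α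
  have hwd_inj : Function.Injective wd := fun α β h => by rw [← hcnt_wd α, ← hcnt_wd β, h]
  -- the coefficient attached to a word: `c_α` on the chosen word of `α`, `0` elsewhere
  let a : (Σ k : ℕ, (Fin k → ι)) → 𝕜 := fun w => if w = wd (cnt w) then coeff (cnt w) P else 0
  have ha_wd : ∀ α, a (wd α) = coeff α P := by
    intro α
    simp only [a, hcnt_wd, if_true]
  have ha_zero : ∀ w, w ∉ Set.range wd → a w = 0 := by
    intro w hw
    simp only [a]
    rw [if_neg]
    intro h
    exact hw ⟨cnt w, h.symm⟩
  -- the multilinear monomials and the formal multilinear series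
  let m : ∀ k : ℕ, (Fin k → ι) → ContinuousMultilinearMap 𝕜 (fun _ : Fin k => ι → 𝕜) 𝕜 :=
    fun k τ => (ContinuousMultilinearMap.mkPiAlgebraFin 𝕜 k 𝕜).compContinuousLinearMap
      fun l => ContinuousLinearMap.proj (R := 𝕜) (φ := fun _ : ι => 𝕜) (τ l)
  let q : FormalMultilinearSeries 𝕜 (ι → 𝕜) 𝕜 := fun k => ∑ τ : Fin k → ι, a ⟨k, τ⟩ • m k τ
  -- `‖P‖_{r'}` is finite
  have hP' : wnorm (fun _ : ι => r') P < ⊤ := lt_of_le_of_lt (wnorm_mono (fun _ => hr'.le) P) hP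
  -- norm bound for `q_k`, word by word
  have hq_norm : ∀ k, ‖q k‖ ≤ ∑ τ : Fin k → ι, ‖a ⟨k, τ⟩‖ := by
    intro k
    refine (norm_sum_le _ _).trans (Finset.sum_le_sum fun τ _ => ?_)
    rw [norm_smul]
    exact (mul_le_mul_of_nonneg_left (norm_wordMap_le τ) (norm_nonneg _)).trans (mul_one _).le
  -- finite partial sums of `‖a_w‖ r'^{|w|}` are bounded by `‖P‖_{r'}`
  have hbound : ∀ T : Finset (Σ k : ℕ, (Fin k → ι)),
      ∑ w ∈ T, ‖a w‖ * (r' : ℝ) ^ w.1 ≤ (wnorm (fun _ : ι => r') P).toReal := by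
    intro T
    -- only the chosen words contribute
    have hsplit : ∑ w ∈ T, ‖a w‖ * (r' : ℝ) ^ w.1 =
        ∑ w ∈ T.filter (fun w => w ∈ Set.range wd), ‖a w‖ * (r' : ℝ) ^ w.1 := by
      rw [Finset.sum_filter]
      refine Finset.sum_congr rfl fun w _ => ?_
      split_ifs with h
      · rfl
      · rw [ha_zero w h, norm_zero, zero_mul]
    rw [hsplit]
    -- reindex the chosen words by their multi-indices
    have hreindex : ∑ w ∈ T.filter (fun w => w ∈ Set.range wd), ‖a w‖ * (r' : ℝ) ^ w.1 =
        ∑ α ∈ (T.filter (fun w => w ∈ Set.range wd)).image cnt,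
          ((‖coeff α P‖₊ * wt (fun _ : ι => r') α : ℝ≥0) : ℝ) := by
      rw [Finset.sum_image]
      · refine Finset.sum_congr rfl fun w hw => ?_
        obtain ⟨α, rfl⟩ := (Finset.mem_filter.1 hw).2
        rw [hcnt_wd, ha_wd, wt_const, NNReal.coe_mul, coe_nnnorm, NNReal.coe_pow]
        congr 2
        have hdeg : (∑ l, Finsupp.single (τw α l) (1 : ℕ)).degree = α.degree := by rw [hτw α]
        change kw α = α.degree
        rw [← hdeg, degree_sum_single]
      · intro w₁ h₁ w₂ h₂ h
        obtain ⟨α₁, rfl⟩ := (Finset.mem_filter.1 (Finset.mem_coe.1 h₁)).2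
        obtain ⟨α₂, rfl⟩ := (Finset.mem_filter.1 (Finset.mem_coe.1 h₂)).2
        rw [hcnt_wd, hcnt_wd] at h
        rw [h]
    rw [hreindex, ← NNReal.coe_sum, ← ENNReal.coe_toReal, ENNReal.ofNNReal_finsetSum]
    refine (ENNReal.toReal_le_toReal (ENNReal.sum_ne_top.2 fun _ _ => ENNReal.coe_ne_top)
      hP'.ne).2 ?_
    exact ENNReal.sum_le_tsum _
  -- hence the radius of `q` is at least `r'`
  have hradius : (r' : ℝ≥0∞) ≤ q.radius := by
    refine q.le_radius_of_summable (summable_of_sum_le (c := (wnorm (fun _ : ι => r') P).toReal)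
      (fun k => mul_nonneg (norm_nonneg _) (pow_nonneg r'.coe_nonneg _)) fun S => ?_)
    calc ∑ k ∈ S, ‖q k‖ * (r' : ℝ) ^ k
        ≤ ∑ k ∈ S, ∑ τ : Fin k → ι, ‖a ⟨k, τ⟩‖ * (r' : ℝ) ^ k := by
          refine Finset.sum_le_sum fun k _ => ?_
          rw [← Finset.sum_mul]
          exact mul_le_mul_of_nonneg_right (hq_norm k) (pow_nonneg r'.coe_nonneg _)
      _ = ∑ w ∈ S.sigma (fun _ => Finset.univ), ‖a w‖ * (r' : ℝ) ^ w.1 := by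
          rw [Finset.sum_sigma]
      _ ≤ (wnorm (fun _ : ι => r') P).toReal := hbound _
  refine ⟨q, hradius, by exact_mod_cast h0, ?_⟩
  -- the expansion: regroup `∑_α c_α y^α` along the words
  intro y hy
  rw [zero_add]
  have hy' : ∀ i, ‖y i‖₊ ≤ r' := by
    intro i
    have h1 : ‖y‖₊ < r' := by
      rw [Metric.mem_eball, edist_zero_right, enorm_eq_nnnorm] at hy
      exact_mod_cast hy
    exact ((nnnorm_le_pi_nnnorm y i).trans h1.le)
  -- the family on words and its sum
  let G : (Σ k : ℕ, (Fin k → ι)) → 𝕜 := fun w => a w * mono y (cnt w)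
  have hG : HasSum G (eval P y) := by
    have h1 : HasSum (G ∘ wd) (eval P y) := by
      have h2 : G ∘ wd = fun α => coeff α P * mono y α := by
        funext α
        simp only [Function.comp_apply, G, ha_wd, hcnt_wd]
      rw [h2]
      exact hasSum_eval hy' hP'
    exact (hwd_inj.hasSum_iff fun w hw => by
      simp only [G, ha_zero w hw, zero_mul]).1 h1
  have hdiag : ∀ k, q k (fun _ => y) = ∑ τ : Fin k → ι, G ⟨k, τ⟩ := by
    intro k
    simp only [q, G, _root_.sum_apply, _root_.smul_apply, smul_eq_mul]
    refine Finset.sum_congr rfl fun τ _ => ?_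
    rw [wordMap_apply_diag]
  have hfin : ∀ k, HasSum (fun τ : Fin k → ι => G ⟨k, τ⟩) (q k fun _ => y) := by
    intro k
    rw [hdiag]
    exact hasSum_fintype _
  exact hG.sigma hfin

/-- **Sums of convergent power series are analytic on the open polydisc of convergence**: if
`‖P‖_r < ∞` then `eval P` is analytic (in Mathlib's sense, over `𝕜`) at every `y` with
`‖yᵢ‖ < r` for all `i` (Ruiz 1993, Prop. 2.6; the re-expansion at `y` is Mathlib's change of
origin, `HasFPowerSeriesOnBall.analyticAt_of_mem`). [cite: Ruiz1993, Prop. 2.6] -/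
theorem analyticAt_eval {r : ℝ≥0} {P : MvPowerSeries ι 𝕜} (hP : wnorm (fun _ : ι => r) P < ⊤)
    {y : ι → 𝕜} (hy : ∀ i, ‖y i‖₊ < r) : AnalyticAt 𝕜 (eval P) y := by
  rcases isEmpty_or_nonempty ι with hι | hι
  · -- no variables: `eval P` is constant
    have h : eval P = fun _ => eval P y := funext fun z => by rw [Subsingleton.elim z y]
    rw [h]
    exact analyticAt_const
  · obtain ⟨i₀⟩ := hι
    have hr : 0 < r := pos_of_gt (hy i₀)
    have hyr : ‖y‖₊ < r := (pi_nnnorm_lt_iff hr).2 hy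
    obtain ⟨r', hyr', hr'⟩ := exists_between hyr
    have h0 : 0 < r' := pos_of_gt hyr'
    obtain ⟨q, hq⟩ := exists_hasFPowerSeriesOnBall_eval hP hr' h0
    refine hq.analyticAt_of_mem ?_
    rw [Metric.mem_eball, edist_zero_right, enorm_eq_nnnorm]
    exact_mod_cast hyr'

end Complete

end Literature.RingTheory.MvPowerSeries

end
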